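import Literature.Barriers.CriticalPhenomena.SupercriticalSAWSpaceFillingTilesUnion
import Literature.Probability.RandomPlanarGeometry.SupercriticalSAWProp3Holds
import HarnessLib

/-!
# Supercritical SAW (Duminil-Copin–Kozma–Yadin 2014): Theorem 6 for the disk, and Theorem 1

Final file of the tile form of the proof of Theorem 6 of H. Duminil-Copin, G. Kozma, A. Yadin,
*Supercritical self-avoiding walks are space-filling*, Ann. IHP Probab. Stat. 50 (2014), §3,
for `Ω = 𝔻`: the evaluation of the two sums of `…TilesUnion.lean` and the choice of constants,
discharging the named fact `DKY2014_thm6_disk` (`SupercriticalSAWSpaceFillingSteps.lean`), hence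
Theorem 1 `DKY2014_thm1` (`DKY2014_thm1_of_thm6_disk`) and the barrier
`SupercriticalSAWSpaceFilling`.

* `sum_main_geom_le` — `Σ_{N ≥ N₀} 25^{N-1} bMain N ≤ 2 C₇ (1/64)^{N₀-1}` once
  `Y = x^{4r+2} Z_m(x) ≥ 1600` (the printed "`Σ_{i ≥ s/(2m+1)²} (λ/Z_m(x))^i ≤ … 2^{-s/(2m+1)²}`");
  `mainSum_le_exp` — `mainSum ≤ (A/δ²) e^{-(log 64/C₃) s}`.
* `annSum_le_exp` — `annSum ≤ (16000/Z_m(x)) e^{-(log Y/(16 L²))/δ²}` for `δ` small (the half-disk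
  families have `≥ 1/(8L²δ²)` tiles while the radii are `≤ 2⌈1/δ⌉`).
* `DKY2014_thm6_disk_holds` — **Theorem 6 for the disk**, with `m = m(x)` from Proposition 3
  (`DKY2014_prop3_holds`, `x^{18} Z_m(x) ≥ 1600`), `r = 4`, `ξ(x) = ρ + 2K + 2h + 1`;
  `DKY2014_thm1_holds`, `SupercriticalSAWSpaceFilling_holds`.
-/

noncomputable section

open MeasureTheory Finset Filter Literature.Probability.LatticeModels Literature.Probability.Percolation
  Literature.Probability.RandomPlanarGeometry.SAW
open scoped ENNReal

namespace Literature.Barriers.CriticalPhenomena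

namespace SupercriticalSAW

variable {m r : ℕ} {δ : ℝ} {u v : Site 2}

/-! ### The main sum -/

/-- The constant `C₇ = 80(ρ+1) max(1,x⁻¹)^{10ρ+3} / Z_m(x)`. [cite: DuminilCopinKozmaYadin2014, Proposition 7 (C(x,m))] -/
def C7 (m r : ℕ) (x : ℝ) : ℝ := 80 * ((rhoP m r : ℝ) + 1) * max 1 x⁻¹ ^ (10 * rhoP m r + 3) / Zbox m x

/-- `25^{N-1} bMain N = C₇ (25/Y)^{N-1}`, `Y = x^{4r+2} Z_m(x)`. [folklore] -/
theorem bMain_eq {x : ℝ} (hx : 0 < x) (hZ : 0 < Zbox m x) {N : ℕ} (hN : 1 ≤ N) :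
    (25 : ℝ) ^ (N - 1) * bMain m r x N = C7 m r x * (25 / (x ^ (4 * r + 2) * Zbox m x)) ^ (N - 1) := by
  obtain ⟨k, rfl⟩ : ∃ k, N = k + 1 := ⟨N - 1, by omega⟩
  simp only [Nat.add_sub_cancel, bMain, C7]
  have e : x ^ ((4 * r + 2) * k) * Zbox m x ^ (k + 1) = Zbox m x * (x ^ (4 * r + 2) * Zbox m x) ^ k := by
    rw [pow_succ, mul_pow, ← pow_mul]; ring
  rw [e, div_pow]
  field_simp

/-- **The geometric tail of the main sum**: `Σ_{N ∈ [N₀, N₁]} 25^{N-1} bMain N ≤ 2 C₇ (1/64)^{N₀-1}`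
when `x^{4r+2} Z_m(x) ≥ 1600` and `N₀ ≥ 1`. [cite: DuminilCopinKozmaYadin2014, §3 (proof of Theorem 6: "Σ_{i ≥ s/(2m+1)²} (λ/Z_m(x))^i")] -/
theorem sum_main_geom_le {x : ℝ} (hx : 0 < x) (hZ : 0 < Zbox m x) (hY : 1600 ≤ x ^ (4 * r + 2) * Zbox m x)
    {N₀ N₁ : ℕ} (hN₀ : 1 ≤ N₀) :
    ∑ N ∈ Finset.Icc N₀ N₁, (25 : ℝ) ^ (N - 1) * bMain m r x N ≤ 2 * C7 m r x * (1 / 64) ^ (N₀ - 1) := by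
  set q : ℝ := 25 / (x ^ (4 * r + 2) * Zbox m x) with hq
  have hq0 : 0 ≤ q := by positivity
  have hq64 : q ≤ 1 / 64 := by
    rw [hq, div_le_div_iff₀ (by positivity) (by norm_num)]; linarith
  have hC7 : 0 ≤ C7 m r x := by unfold C7; positivity
  have hterm : ∀ N ∈ Finset.Icc N₀ N₁, (25 : ℝ) ^ (N - 1) * bMain m r x N ≤ C7 m r x * ((1 / 64) ^ (N₀ - 1) * q ^ (N - N₀)) := by
    intro N hN
    rw [Finset.mem_Icc] at hN
    rw [bMain_eq hx hZ (hN₀.trans hN.1)]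
    refine mul_le_mul_of_nonneg_left ?_ hC7
    calc q ^ (N - 1) = q ^ (N₀ - 1) * q ^ (N - N₀) := by rw [← pow_add]; congr 1; omega
      _ ≤ (1 / 64) ^ (N₀ - 1) * q ^ (N - N₀) :=
          mul_le_mul_of_nonneg_right (pow_le_pow_left₀ hq0 hq64 _) (pow_nonneg hq0 _)
  refine (Finset.sum_le_sum hterm).trans ?_
  rw [← Finset.mul_sum, ← Finset.mul_sum]
  -- the geometric sum `Σ_{N ∈ [N₀, N₁]} q^{N - N₀} ≤ 2`
  have hgeom : ∑ N ∈ Finset.Icc N₀ N₁, q ^ (N - N₀) ≤ 2 := by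
    rcases le_or_gt N₀ N₁ with hle | hlt
    · rw [← Finset.Ico_add_one_right_eq_Icc, Finset.sum_Ico_eq_sum_range]
      simp only [Nat.add_sub_cancel_left]
      have := geom_sum_Ico_le_of_lt_one (m := 0) (n := N₁ + 1 - N₀) hq0 (by linarith)
      rw [Finset.range_eq_Ico] at *
      refine this.trans ?_
      rw [pow_zero, div_le_iff₀ (by linarith)]; linarith
    · rw [Finset.Icc_eq_empty_of_lt hlt, Finset.sum_empty]; norm_num
  calc C7 m r x * ((1 / 64 : ℝ) ^ (N₀ - 1) * ∑ N ∈ Finset.Icc N₀ N₁, q ^ (N - N₀))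
      ≤ C7 m r x * ((1 / 64 : ℝ) ^ (N₀ - 1) * 2) :=
        mul_le_mul_of_nonneg_left (mul_le_mul_of_nonneg_left hgeom (by positivity)) hC7
    _ = _ := by ring

/-- `(1/64)^{⌊s/C₃⌋} ≤ 64 e^{-(log 64/C₃) s}` for `s ≥ 0`, `C₃ > 0`. [folklore] -/
theorem pow_inv64_floor_le (s C : ℝ) :
    ((1 : ℝ) / 64) ^ ⌊s / C⌋₊ ≤ 64 * Real.exp (-(Real.log 64 / C * s)) := by
  have h64 : (0 : ℝ) < 64 := by norm_num
  have h1 : ((1 : ℝ) / 64) ^ ⌊s / C⌋₊ = Real.exp (⌊s / C⌋₊ * (-Real.log 64)) := by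
    rw [Real.exp_nat_mul, Real.exp_neg, Real.exp_log h64, one_div]
  have h2 : (64 : ℝ) * Real.exp (-(Real.log 64 / C * s)) = Real.exp (Real.log 64 + -(Real.log 64 / C * s)) := by
    rw [Real.exp_add, Real.exp_log h64]
  rw [h1, h2, Real.exp_le_exp]
  have h3 : s / C - 1 ≤ ⌊s / C⌋₊ := by
    have := Nat.lt_floor_add_one (s / C); linarith
  have hlog : 0 < Real.log 64 := Real.log_pos (by norm_num)
  have : Real.log 64 / C * s = Real.log 64 * (s / C) := by ring
  rw [this]
  nlinarith

/-- At most `25/δ²` deep tiles (`0 < δ ≤ 1`). [cite: DuminilCopinKozmaYadin2014, §3 (C(Ω)/δ²)] -/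
theorem card_deepTiles_le (hδ : 0 < δ) (hδ1 : δ ≤ 1) (m r Rd : ℕ) : ((deepTiles δ m r Rd).card : ℝ) ≤ 25 / δ ^ 2 := by
  classical
  have h1 : (deepTiles δ m r Rd).card ≤ (2 * ⌈1 / δ⌉₊ + 1) ^ 2 :=
    (Finset.card_le_card (Finset.filter_subset _ _)).trans (by rw [card_box])
  have h2 : ((deepTiles δ m r Rd).card : ℝ) ≤ ((2 * ⌈1 / δ⌉₊ + 1 : ℕ) : ℝ) ^ 2 := by exact_mod_cast h1
  exact h2.trans (ceil_sq_le hδ hδ1)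

/-- The constant of the main term: `A = 12800 L C₇ · 25 · 4`… precisely `25 · 4 · L · 2 C₇ · 64`.
[folklore] -/
def Amain (m r : ℕ) (x : ℝ) : ℝ := 25 * (4 * (OddTile.side m r * (2 * C7 m r x * 64)))

/-- **The main sum is exponentially small in `s`**: `mainSum ≤ (A/δ²) e^{-(log 64/C₃) s}`.
[cite: DuminilCopinKozmaYadin2014, §3 (proof of Theorem 6: "P[𝒜(s)] ≤ C(x,m)(C(Ω)/δ²) Σ … ≤ (C(x,m,Ω)/δ²) 2^{-s/(2m+1)²}")] -/
theorem mainSum_le_exp (hδ : 0 < δ) (hδ1 : δ ≤ 1) {x : ℝ} (hx : 0 < x) (hZ : 0 < Zbox m x)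
    (hY : 1600 ≤ x ^ (4 * r + 2) * Zbox m x) (s : ℝ) :
    mainSum m r δ x s ≤ Amain m r x / δ ^ 2 * Real.exp (-(Real.log 64 / C3P m r * s)) := by
  have hC7 : 0 ≤ C7 m r x := by unfold C7; positivity
  have hC3 : (0 : ℝ) < C3P m r := by unfold C3P; positivity
  have h1 := mainSum_le (m := m) (r := r) (δ := δ) hx hZ s
  have h2 := sum_main_geom_le (m := m) (r := r) hx hZ hY (N₀ := ⌊s / C3P m r⌋₊ + 1)
    (N₁ := (deepTiles δ m r (RdP m r)).card) (by omega)
  simp only [Nat.add_sub_cancel] at h2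
  have h3 := pow_inv64_floor_le s (C3P m r : ℝ)
  have h4 := card_deepTiles_le hδ hδ1 m r (RdP m r)
  have hL : (0 : ℝ) ≤ OddTile.side m r := by positivity
  have hE := Real.exp_pos (-(Real.log 64 / C3P m r * s))
  refine h1.trans ?_
  have inner : ∑ N ∈ Finset.Icc (⌊s / C3P m r⌋₊ + 1) (deepTiles δ m r (RdP m r)).card, (25 : ℝ) ^ (N - 1) * bMain m r x N ≤
      2 * C7 m r x * (64 * Real.exp (-(Real.log 64 / C3P m r * s))) :=
    h2.trans (mul_le_mul_of_nonneg_left h3 (by positivity))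
  have hS : 0 ≤ ∑ N ∈ Finset.Icc (⌊s / C3P m r⌋₊ + 1) (deepTiles δ m r (RdP m r)).card, (25 : ℝ) ^ (N - 1) * bMain m r x N :=
    Finset.sum_nonneg fun N _ => mul_nonneg (pow_nonneg (by norm_num) _) (bMain_nonneg hx hZ N)
  have hδ2 : (0 : ℝ) ≤ 25 / δ ^ 2 := by positivity
  have step : ((deepTiles δ m r (RdP m r)).card : ℝ) * (4 * (OddTile.side m r *
      ∑ N ∈ Finset.Icc (⌊s / C3P m r⌋₊ + 1) (deepTiles δ m r (RdP m r)).card, (25 : ℝ) ^ (N - 1) * bMain m r x N)) ≤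
      (25 / δ ^ 2) * (4 * (OddTile.side m r * (2 * C7 m r x * (64 * Real.exp (-(Real.log 64 / C3P m r * s)))))) :=
    mul_le_mul h4 (mul_le_mul_of_nonneg_left (mul_le_mul_of_nonneg_left inner hL) (by norm_num))
      (mul_nonneg (by norm_num) (mul_nonneg hL hS)) hδ2
  refine step.trans_eq ?_
  unfold Amain; ring

/-! ### The annular sum -/

/-- The side parameter `M = ⌊1/(2Lδ)⌋ - Rd` of the deep square. [folklore] -/
def Mpar (m r : ℕ) (δ : ℝ) : ℕ := ⌊1 / (2 * OddTile.side m r * δ)⌋₊ - RdP m r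

/-- **All tiles with `|τ|_∞ ≤ M` are deep** (their `Rd`-neighbourhoods have coordinates
`≤ 1/(2δ)` in absolute value), provided `Rd ≤ 1/(2δ)`. [folklore] -/
theorem isDeepTile_of_le_Mpar (hδ : 0 < δ) (hRd : (RdP m r : ℝ) ≤ 1 / (2 * δ)) {τ : Site 2}
    (hτ : ∀ k, |τ k| ≤ Mpar m r δ) : IsDeepTile δ m r (RdP m r) τ := by
  intro w hw
  have hL : (1 : ℝ) ≤ OddTile.side m r := by exact_mod_cast OddTile.side_pos (m := m) (r := r)
  -- `L · M + Rd ≤ 1/(2δ)`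
  have hM : (OddTile.side m r : ℝ) * (Mpar m r δ : ℕ) + RdP m r ≤ 1 / (2 * δ) := by
    unfold Mpar
    have hfloor : ((⌊1 / (2 * OddTile.side m r * δ)⌋₊ : ℕ) : ℝ) ≤ 1 / (2 * OddTile.side m r * δ) :=
      Nat.floor_le (by positivity)
    by_cases hcase : RdP m r ≤ ⌊1 / (2 * OddTile.side m r * δ)⌋₊
    · rw [Nat.cast_sub hcase]
      have e : (OddTile.side m r : ℝ) * (1 / (2 * OddTile.side m r * δ)) = 1 / (2 * δ) := by
        field_simp
      nlinarith [mul_le_mul_of_nonneg_left hfloor (by positivity : (0 : ℝ) ≤ OddTile.side m r),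
        (Nat.cast_nonneg (RdP m r) : (0 : ℝ) ≤ RdP m r)]
    · rw [Nat.sub_eq_zero_of_le (not_le.1 hcase).le]; simpa using hRd
  -- each coordinate of `w` is at most `1/(2δ)` in absolute value
  have hcoord : ∀ i, |((w i : ℤ) : ℝ)| ≤ 1 / (2 * δ) := by
    intro i
    have h1 := hw i
    have h2 := hτ i
    have h3 : |w i| ≤ OddTile.side m r * Mpar m r δ + RdP m r := by
      rw [OddTile.ctr_apply] at h1
      have := abs_sub_abs_le_abs_sub (w i) ((OddTile.side m r : ℤ) * τ i)
      have h4 : |(OddTile.side m r : ℤ) * τ i| ≤ OddTile.side m r * Mpar m r δ := by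
        rw [abs_mul, abs_of_nonneg (by positivity : (0 : ℤ) ≤ OddTile.side m r)]
        exact mul_le_mul_of_nonneg_left h2 (by positivity)
      omega
    have h5 : (|((w i : ℤ) : ℝ)|) ≤ ((OddTile.side m r * Mpar m r δ + RdP m r : ℤ) : ℝ) := by
      rw [← Int.cast_abs]; exact_mod_cast h3
    push_cast at h5
    linarith
  rw [mem_meshDomain_unitDisk_iff_lt_sq hδ, Fin.sum_univ_two]
  have h0 := hcoord 0; have h1 := hcoord 1
  have hsq : ∀ {t : ℝ}, |t| ≤ 1 / (2 * δ) → t ^ 2 ≤ (1 / (2 * δ)) ^ 2 := fun ht =>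
    by rw [← sq_abs]; exact pow_le_pow_left₀ (abs_nonneg _) ht 2
  have e : (1 / (2 * δ)) ^ 2 + (1 / (2 * δ)) ^ 2 < (1 / δ) ^ 2 := by
    have : (1 / (2 * δ)) ^ 2 + (1 / (2 * δ)) ^ 2 = (1 / δ) ^ 2 / 2 := by field_simp; ring
    rw [this]; have : 0 < (1 / δ) ^ 2 := by positivity
    linarith
  linarith [hsq h0, hsq h1]

/-- **`M` is large**: for `δ ≤ 1/(8L(Rd+2))`, `M ≥ 1` and `M² - 1 ≥ 1/(8L²δ²)`, and `Rd ≤ 1/(2δ)`.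
[folklore] -/
theorem Mpar_bounds (hδ : 0 < δ) (hδM : δ ≤ 1 / (8 * OddTile.side m r * ((RdP m r : ℝ) + 2))) :
    1 ≤ Mpar m r δ ∧ 1 / (8 * (OddTile.side m r : ℝ) ^ 2 * δ ^ 2) ≤ ((Mpar m r δ : ℕ) : ℝ) ^ 2 - 1 ∧
      (RdP m r : ℝ) ≤ 1 / (2 * δ) := by
  have hL : (1 : ℝ) ≤ OddTile.side m r := by exact_mod_cast OddTile.side_pos (m := m) (r := r)
  have hRd0 : (0 : ℝ) ≤ RdP m r := Nat.cast_nonneg _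
  set L : ℝ := (OddTile.side m r : ℝ) with hLdef
  set R : ℝ := (RdP m r : ℝ) with hRdef
  -- `1/(2Lδ) ≥ 4 (Rd + 2)`
  have hbig : 4 * (R + 2) ≤ 1 / (2 * L * δ) := by
    rw [le_div_iff₀ (by positivity)]
    have := mul_le_mul_of_nonneg_left hδM (by positivity : (0 : ℝ) ≤ 8 * L * (R + 2))
    calc 4 * (R + 2) * (2 * L * δ) = 8 * L * (R + 2) * δ := by ring
      _ ≤ 8 * L * (R + 2) * (1 / (8 * L * (R + 2))) := this
      _ = 1 := by field_simp
  have hfloor := Nat.lt_floor_add_one (1 / (2 * L * δ))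
  have hfloor' := Nat.floor_le (show (0 : ℝ) ≤ 1 / (2 * L * δ) by positivity)
  have hcase : RdP m r ≤ ⌊1 / (2 * L * δ)⌋₊ := by
    have : (RdP m r : ℝ) ≤ ⌊1 / (2 * L * δ)⌋₊ := by linarith
    exact_mod_cast this
  have hMreal : ((Mpar m r δ : ℕ) : ℝ) = ⌊1 / (2 * L * δ)⌋₊ - R := by
    unfold Mpar; rw [← hLdef, Nat.cast_sub hcase]
  have hMge : 3 / (8 * L * δ) ≤ ((Mpar m r δ : ℕ) : ℝ) := by
    rw [hMreal]
    have e : 3 / (8 * L * δ) = 1 / (2 * L * δ) - 1 / (8 * L * δ) := by field_simp; ring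
    have : R + 1 ≤ 1 / (8 * L * δ) := by
      have e2 : 1 / (8 * L * δ) = (1 / (2 * L * δ)) / 4 := by field_simp; ring
      rw [e2]; linarith
    linarith
  refine ⟨?_, ?_, ?_⟩
  · have : (1 : ℝ) ≤ ((Mpar m r δ : ℕ) : ℝ) := by
      refine le_trans ?_ hMge
      rw [le_div_iff₀ (by positivity)]
      have := mul_le_mul_of_nonneg_left hδM (by positivity : (0 : ℝ) ≤ 8 * L)
      calc 1 * (8 * L * δ) = 8 * L * δ := by ring
        _ ≤ 8 * L * (1 / (8 * L * (R + 2))) := this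
        _ = 1 / (R + 2) := by field_simp
        _ ≤ 3 := by rw [div_le_iff₀ (by positivity)]; linarith
    exact_mod_cast this
  · -- `M² ≥ 9/(64 L² δ²)` and `1 ≤ 1/(64 L² δ²)`
    have hM2 : (3 / (8 * L * δ)) ^ 2 ≤ ((Mpar m r δ : ℕ) : ℝ) ^ 2 := pow_le_pow_left₀ (by positivity) hMge 2
    have hδL : δ ≤ 1 / (8 * L) := hδM.trans (by
      rw [div_le_div_iff₀ (by positivity) (by positivity)]; nlinarith)
    have h64 : (1 : ℝ) ≤ 1 / (64 * L ^ 2 * δ ^ 2) := by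
      rw [le_div_iff₀ (by positivity)]
      have : L * δ ≤ 1 / 8 := by
        calc L * δ ≤ L * (1 / (8 * L)) := mul_le_mul_of_nonneg_left hδL (by positivity)
          _ = 1 / 8 := by field_simp
      have h0 : 0 ≤ L * δ := by positivity
      nlinarith
    have e1 : (3 / (8 * L * δ)) ^ 2 = 9 * (1 / (64 * L ^ 2 * δ ^ 2)) := by field_simp; ring
    have e2 : 1 / (8 * L ^ 2 * δ ^ 2) = 8 * (1 / (64 * L ^ 2 * δ ^ 2)) := by field_simp; ring
    rw [e2]; rw [e1] at hM2
    linarith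
  · have : R ≤ R + 2 := by linarith
    calc R ≤ 4 * (R + 2) := by linarith
      _ ≤ 1 / (2 * L * δ) := hbig
      _ ≤ 1 / (2 * δ) := by
          rw [div_le_div_iff₀ (by positivity) (by positivity)]; nlinarith

/-- `t² ≤ e^{2t}` for `0 ≤ t`. [folklore] -/
theorem sq_le_exp_two_mul {t : ℝ} (ht : 0 ≤ t) : t ^ 2 ≤ Real.exp (2 * t) := by
  have h1 := Real.add_one_le_exp t
  have h3 : Real.exp (2 * t) = Real.exp t ^ 2 := by rw [← Real.exp_nat_mul]; norm_num
  rw [h3]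
  calc t ^ 2 ≤ (t + 1) ^ 2 := pow_le_pow_left₀ ht (by linarith) 2
    _ ≤ Real.exp t ^ 2 := pow_le_pow_left₀ (by linarith) h1 2

/-- The real core of the annular estimate: for `t ≥ 1`, `ℓ ≥ 0`, `a > 0`, `Z > 0` and
`2 + 43ℓ ≤ (a/2) t`, `8·5t·(80·5t·e^{43ℓt}/Z·e^{-a t²}) ≤ (16000/Z) e^{-(a/2) t²}`. [folklore] -/
theorem ann_core {t ℓ a Z : ℝ} (ht : 1 ≤ t) (hZ : 0 < Z) (hta : 2 + 43 * ℓ ≤ a / 2 * t) :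
    8 * (5 * t) * (80 * (5 * t) * Real.exp (43 * ℓ * t) / Z * Real.exp (-(a * t ^ 2))) ≤
      16000 / Z * Real.exp (-(a / 2 * t ^ 2)) := by
  have e1 : 8 * (5 * t) * (80 * (5 * t) * Real.exp (43 * ℓ * t) / Z * Real.exp (-(a * t ^ 2))) =
      16000 / Z * (t ^ 2 * Real.exp (43 * ℓ * t + -(a * t ^ 2))) := by
    rw [Real.exp_add]; ring
  rw [e1]
  refine mul_le_mul_of_nonneg_left ?_ (by positivity)
  have h1 : t ^ 2 ≤ Real.exp (2 * t) := sq_le_exp_two_mul (by linarith)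
  calc t ^ 2 * Real.exp (43 * ℓ * t + -(a * t ^ 2)) ≤ Real.exp (2 * t) * Real.exp (43 * ℓ * t + -(a * t ^ 2)) :=
        mul_le_mul_of_nonneg_right h1 (Real.exp_pos _).le
    _ = Real.exp (2 * t + 43 * ℓ * t + -(a * t ^ 2)) := by rw [← Real.exp_add]; ring_nf
    _ ≤ Real.exp (-(a / 2 * t ^ 2)) := by
        rw [Real.exp_le_exp]
        have := mul_le_mul_of_nonneg_right hta (by linarith : (0 : ℝ) ≤ t)
        nlinarith

/-- The real-variable core of the annular estimate. [folklore] -/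
theorem ann_real_core {δ L Y Z xp Mr Dr : ℝ} {n k : ℕ} (hδ : 0 < δ) (hδ1 : δ ≤ 1) (hL : 1 ≤ L) (hY : 1 < Y)
    (hZ : 0 < Z) (hxp : 1 ≤ xp) (hM : 1 / (8 * L ^ 2 * δ ^ 2) ≤ Mr ^ 2 - 1) (hk : (k : ℝ) = Mr ^ 2 - 1)
    (hDr : 0 ≤ Dr) (hD : Dr + 1 ≤ 5 * (1 / δ)) (hn : (n : ℝ) ≤ 43 * (1 / δ))
    (hδA : δ ≤ Real.log Y / (16 * L ^ 2 * (43 * Real.log xp + 2))) :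
    8 * (Dr + 1) * (80 * (Dr + 1) * xp ^ n / (Z * Y ^ k)) ≤
      16000 / Z * Real.exp (-(Real.log Y / (16 * L ^ 2) * (1 / δ) ^ 2)) := by
  have hlogY : 0 < Real.log Y := Real.log_pos hY
  have hℓ : 0 ≤ Real.log xp := Real.log_nonneg hxp
  have ht1 : 1 ≤ 1 / δ := by rw [le_div_iff₀ hδ]; linarith
  -- the power of `xp`
  have hpow : xp ^ n ≤ Real.exp (43 * Real.log xp * (1 / δ)) := by
    have e1 : xp ^ n = Real.exp (n * Real.log xp) := by rw [Real.exp_nat_mul, Real.exp_log (by linarith)]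
    rw [e1, Real.exp_le_exp]
    nlinarith
  -- the power of `Y`
  have hYpow : (Y ^ k)⁻¹ ≤ Real.exp (-(Real.log Y / (8 * L ^ 2) * (1 / δ) ^ 2)) := by
    have e1 : (Y ^ k)⁻¹ = Real.exp (-(k * Real.log Y)) := by
      rw [Real.exp_neg, Real.exp_nat_mul, Real.exp_log (by linarith)]
    rw [e1, Real.exp_le_exp, neg_le_neg_iff, hk]
    have e2 : Real.log Y / (8 * L ^ 2) * (1 / δ) ^ 2 = Real.log Y * (1 / (8 * L ^ 2 * δ ^ 2)) := by field_simp
    rw [e2, mul_comm (Mr ^ 2 - 1)]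
    exact mul_le_mul_of_nonneg_left hM hlogY.le
  -- the piece bound
  have hB : 80 * (Dr + 1) * xp ^ n / (Z * Y ^ k) ≤
      80 * (5 * (1 / δ)) * Real.exp (43 * Real.log xp * (1 / δ)) / Z *
        Real.exp (-(Real.log Y / (8 * L ^ 2) * (1 / δ) ^ 2)) := by
    have e1 : 80 * (Dr + 1) * xp ^ n / (Z * Y ^ k) = (80 * (Dr + 1) * xp ^ n) / Z * (Y ^ k)⁻¹ := by
      rw [div_mul_eq_div_div, div_eq_mul_inv _ (Y ^ k)]
    rw [e1]
    have hnum : 80 * (Dr + 1) * xp ^ n ≤ 80 * (5 * (1 / δ)) * Real.exp (43 * Real.log xp * (1 / δ)) :=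
      mul_le_mul (by linarith) hpow (pow_nonneg (by linarith) _) (by positivity)
    have hY0 : 0 ≤ (Y ^ k)⁻¹ := by positivity
    exact mul_le_mul (div_le_div_of_nonneg_right hnum hZ.le) hYpow hY0 (by positivity)
  have hBnonneg : 0 ≤ 80 * (Dr + 1) * xp ^ n / (Z * Y ^ k) := by
    have : 0 ≤ xp ^ n := pow_nonneg (by linarith) _
    have : 0 < Y ^ k := pow_pos (by linarith) _
    positivity
  have h2 : 8 * (Dr + 1) * (80 * (Dr + 1) * xp ^ n / (Z * Y ^ k)) ≤
      8 * (5 * (1 / δ)) * (80 * (5 * (1 / δ)) * Real.exp (43 * Real.log xp * (1 / δ)) / Z *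
        Real.exp (-(Real.log Y / (8 * L ^ 2) * (1 / δ) ^ 2))) :=
    mul_le_mul (mul_le_mul_of_nonneg_left hD (by norm_num)) hB hBnonneg (by positivity)
  -- the exponent condition from `hδA`
  have hta : 2 + 43 * Real.log xp ≤ Real.log Y / (8 * L ^ 2) / 2 * (1 / δ) := by
    have hden : 0 < 16 * L ^ 2 * (43 * Real.log xp + 2) :=
      mul_pos (mul_pos (by norm_num) (pow_pos (by linarith) 2)) (by linarith)
    have h3 : δ * (16 * L ^ 2 * (43 * Real.log xp + 2)) ≤ Real.log Y := (le_div_iff₀ hden).1 hδA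
    have e : Real.log Y / (8 * L ^ 2) / 2 * (1 / δ) = Real.log Y / (16 * L ^ 2 * δ) := by field_simp; ring
    have hL2δ : 0 < 16 * L ^ 2 * δ := by positivity
    rw [e, le_div_iff₀ hL2δ]
    calc (2 + 43 * Real.log xp) * (16 * L ^ 2 * δ) = δ * (16 * L ^ 2 * (43 * Real.log xp + 2)) := by ring
      _ ≤ Real.log Y := h3
  refine h2.trans ((ann_core ht1 hZ hta).trans_eq ?_)
  congr 1
  congr 1
  ring

/-- **The annular sum is `e^{-c/δ²}` small**: with `Y = x^{4r+2} Z_m(x) ≥ 1600`, for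
`0 < δ ≤ min(1, 1/(8L(Rd+2)), log Y/(16 L² (43 log max(1,x⁻¹) + 2)))`,
`annSum ≤ (16000/Z_m(x)) e^{-(log Y/(16L²))/δ²}`. [cite: DuminilCopinKozmaYadin2014, §3 (proof of Theorem 6)] -/
theorem annSum_le_exp (hδ : 0 < δ) (hδ1 : δ ≤ 1)
    (hδM : δ ≤ 1 / (8 * OddTile.side m r * ((RdP m r : ℝ) + 2))) {x : ℝ} (hx : 0 < x) (hZ : 0 < Zbox m x)
    (hY : 1600 ≤ x ^ (4 * r + 2) * Zbox m x)
    (hδA : δ ≤ Real.log (x ^ (4 * r + 2) * Zbox m x) /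
      (16 * (OddTile.side m r : ℝ) ^ 2 * (43 * Real.log (max 1 x⁻¹) + 2))) :
    annSum m r δ x ≤ 16000 / Zbox m x *
      Real.exp (-(Real.log (x ^ (4 * r + 2) * Zbox m x) / (16 * (OddTile.side m r : ℝ) ^ 2) * (1 / δ) ^ 2)) := by
  have hL1 : (1 : ℝ) ≤ OddTile.side m r := by exact_mod_cast OddTile.side_pos (m := m) (r := r)
  have hY1 : (1 : ℝ) ≤ x ^ (4 * r + 2) * Zbox m x := by linarith
  obtain ⟨hM1, hM2, hRd⟩ := Mpar_bounds (m := m) (r := r) hδ hδM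
  have hdeepM : ∀ τ : Site 2, (∀ k, |τ k| ≤ Mpar m r δ) → IsDeepTile δ m r (RdP m r) τ := fun τ hτ =>
    isDeepTile_of_le_Mpar hδ hRd hτ
  have hMF : ∀ G ∈ framesAt (0 : Site 2), Mpar m r δ ^ 2 ≤ (halfFamily δ m r (RdP m r) G).card := fun G hG =>
    card_halfFamily_ge hδ G (z₀_of_mem_framesAt hG) hdeepM
  have h1 := annSum_le (m := m) (r := r) hδ hx hZ hY1 hMF hM1
  have hceil : ((⌈1 / δ⌉₊ : ℕ) : ℝ) < 1 / δ + 1 := Nat.ceil_lt_add_one (by positivity)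
  have hinvδ : (1 : ℝ) ≤ 1 / δ := by rw [le_div_iff₀ hδ]; linarith
  have hk : (((Mpar m r δ ^ 2 - 1 : ℕ)) : ℝ) = ((Mpar m r δ : ℕ) : ℝ) ^ 2 - 1 := by
    have : 1 ≤ Mpar m r δ ^ 2 := by nlinarith
    push_cast [Nat.cast_sub this]; ring
  have hD : ((2 * ⌈1 / δ⌉₊ : ℕ) : ℝ) + 1 ≤ 5 * (1 / δ) := by push_cast; linarith
  have hn : ((10 * (2 * ⌈1 / δ⌉₊) + 3 : ℕ) : ℝ) ≤ 43 * (1 / δ) := by push_cast; linarith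
  have := ann_real_core (Dr := ((2 * ⌈1 / δ⌉₊ : ℕ) : ℝ)) hδ hδ1 hL1 (by linarith) hZ (le_max_left 1 x⁻¹) hM2 hk
    (by positivity) hD hn hδA
  push_cast at h1 this ⊢
  exact h1.trans this

/-! ### Theorem 6 for the disk, Theorem 1, and the barrier -/

/-- **Theorem 6 of Duminil-Copin–Kozma–Yadin 2014 for the unit disk (proved).** For every
`x > x_c` there are `ξ = ξ(x) > 0`, `c = c(x) > 0`, `C = C(x)` such that for all boundary points
`a ≠ b` of `𝔻`, all small meshes `δ` and all closest sites `a_δ, b_δ`,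
`P_{(𝔻_δ,a_δ,b_δ,x)}[some component of 𝔻_δ ∖ Γ_δ^ξ has more than s sites] ≤ (C/δ²) e^{-c s}`.
Here `m = m(x)` is given by Proposition 3 (`x^{18} Z_m(x) ≥ 1600`), the tiles have margin
`r = 4`, and `ξ = ρ + 2K + 2h + 1` (`…TilesPieces.lean`); the bound is the Peierls sum of
`…TilesUnion.lean` evaluated in this file. [cite: DuminilCopinKozmaYadin2014, Theorem 6] -/
theorem DKY2014_thm6_disk_holds : DKY2014_thm6_disk := by
  intro x hxc
  have hx : 0 < x := criticalFugacity_nonneg.trans_lt hxc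
  -- Proposition 3: the polygon parameter `m`
  obtain ⟨m, hm⟩ := (DKY2014_prop3_holds x hxc (1600 / x ^ 18)).exists
  have hx18 : 0 < x ^ 18 := by positivity
  have hY : 1600 ≤ x ^ (4 * 4 + 2) * Zbox m x := by
    rw [div_le_iff₀ hx18] at hm
    norm_num; linarith
  have hZ : 0 < Zbox m x := lt_of_lt_of_le (by positivity) hm
  set Y : ℝ := x ^ (4 * 4 + 2) * Zbox m x with hYdef
  set L : ℝ := (OddTile.side m 4 : ℝ) with hLdef
  have hL1 : 1 ≤ L := by rw [hLdef]; exact_mod_cast OddTile.side_pos (m := m) (r := 4)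
  have hlogY : 0 < Real.log Y := Real.log_pos (by linarith)
  have hlogxp : 0 ≤ Real.log (max 1 x⁻¹) := Real.log_nonneg (le_max_left _ _)
  -- the constants
  set cM : ℝ := Real.log 64 / C3P m 4 with hcM
  set cB : ℝ := Real.log Y / (16 * L ^ 2) with hcB
  set A : ℝ := Amain m 4 x with hA
  set CB : ℝ := 16000 / Zbox m x with hCB
  have hC3 : (0 : ℝ) < C3P m 4 := Nat.cast_pos.2 (by unfold C3P; positivity)
  have hcM0 : 0 < cM := by rw [hcM]; exact div_pos (Real.log_pos (by norm_num)) hC3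
  have hcB0 : 0 < cB := by rw [hcB]; exact div_pos hlogY (by positivity)
  have hρ0 : (0 : ℝ) ≤ (rhoP m 4 : ℝ) + 1 := by have := Nat.cast_nonneg (α := ℝ) (rhoP m 4); linarith
  have hC70 : 0 ≤ C7 m 4 x := by
    unfold C7
    exact div_nonneg (mul_nonneg (mul_nonneg (by norm_num) hρ0) (pow_nonneg (zero_le_one.trans (le_max_left _ _)) _)) hZ.le
  have hA0 : 0 ≤ A := by
    rw [hA]; unfold Amain
    have hL0 : (0 : ℝ) ≤ (OddTile.side m 4 : ℝ) := Nat.cast_nonneg _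
    exact mul_nonneg (by norm_num) (mul_nonneg (by norm_num) (mul_nonneg hL0
      (mul_nonneg (mul_nonneg (by norm_num) hC70) (by norm_num))))
  refine ⟨(xiP m 4 : ℝ), Nat.cast_pos.2 (by unfold xiP; omega), min cM (cB / 25), lt_min hcM0 (div_pos hcB0 (by norm_num)),
    A + max CB 0, fun a b ha hb hab => ?_⟩
  -- the mesh threshold
  have hab' : 0 < ‖a - b‖ := norm_pos_iff.2 (sub_ne_zero.2 hab)
  set δ₀ : ℝ := min (min (1 / 10) (1 / (KP m 4 : ℝ) ^ 2)) (min (‖a - b‖ / 26)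
    (min (1 / (8 * L * ((RdP m 4 : ℝ) + 2))) (Real.log Y / (16 * L ^ 2 * (43 * Real.log (max 1 x⁻¹) + 2))))) with hδ₀
  have hK : (0 : ℝ) < KP m 4 := Nat.cast_pos.2 (by unfold KP; omega)
  have hRd2 : (0 : ℝ) < (RdP m 4 : ℝ) + 2 := by have := Nat.cast_nonneg (α := ℝ) (RdP m 4); linarith
  refine ⟨δ₀, ?_, fun δ hδ hδlt u v hu hv s hs => ?_⟩
  · rw [hδ₀]
    refine lt_min (lt_min (by norm_num) (one_div_pos.2 (pow_pos hK 2))) (lt_min (div_pos hab' (by norm_num))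
      (lt_min (one_div_pos.2 (mul_pos (mul_pos (by norm_num) (by linarith)) hRd2)) ?_))
    exact div_pos hlogY (mul_pos (mul_pos (by norm_num) (pow_pos (by linarith) 2)) (by linarith))
  -- unpack the smallness of `δ`
  have hδ10 : δ ≤ 1 / 10 := hδlt.le.trans ((min_le_left _ _).trans (min_le_left _ _))
  have hδK : δ ≤ 1 / (KP m 4 : ℝ) ^ 2 := hδlt.le.trans ((min_le_left _ _).trans (min_le_right _ _))
  have hδab : δ ≤ ‖a - b‖ / 26 := hδlt.le.trans ((min_le_right _ _).trans (min_le_left _ _))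
  have hδM : δ ≤ 1 / (8 * L * ((RdP m 4 : ℝ) + 2)) :=
    hδlt.le.trans ((min_le_right _ _).trans ((min_le_right _ _).trans (min_le_left _ _)))
  have hδA : δ ≤ Real.log Y / (16 * L ^ 2 * (43 * Real.log (max 1 x⁻¹) + 2)) :=
    hδlt.le.trans ((min_le_right _ _).trans ((min_le_right _ _).trans (min_le_right _ _)))
  have hδ1 : δ ≤ 1 := hδ10.trans (by norm_num)
  have hδ4 : δ ≤ 1 / 4 := hδ10.trans (by norm_num)
  -- the endpoints are far apart
  have huv : 10 ≤ l1dist u v := by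
    obtain ⟨i, hi⟩ := exists_le_abs_sub_of_isClosestSite hδ hδ4 ha hb hu hv (Λ := 10) (by push_cast; linarith)
    simp only [l1dist]
    have := abs_nonneg (u 0 - v 0); have := abs_nonneg (u 1 - v 1)
    fin_cases i <;> simp at hi <;> omega
  -- the deep square
  obtain ⟨hM1, -, hRd⟩ := Mpar_bounds (m := m) (r := 4) hδ hδM
  have hdeepM : ∀ τ : Site 2, (∀ k, |τ k| ≤ Mpar m 4 δ) → IsDeepTile δ m 4 (RdP m 4) τ := fun τ hτ =>
    isDeepTile_of_le_Mpar hδ hRd hτ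
  -- large `s`: the event is empty
  by_cases hsbig : ((2 * ⌈1 / δ⌉₊ + 1 : ℕ) : ℝ) ^ 2 ≤ s
  · have hempty : {γ : DomainSAW unitDisk δ u v | HasLargeHole (xiP m 4 : ℝ) s γ} = ∅ := by
      ext γ
      simp only [Set.mem_setOf_eq, Set.mem_empty_iff_false, iff_false]
      intro h
      have := lt_of_hasLargeHole hδ h
      push_cast at this hsbig
      linarith
    rw [hempty, measure_empty]; exact bot_le
  push Not at hsbig
  have hs25 : s < 25 / δ ^ 2 := hsbig.trans_le (ceil_sq_le hδ hδ1)
  -- the Peierls sum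
  have hsum := lawAt_hasLargeHole_le_sums (m := m) (r := 4) hδ hδ10 hδK le_rfl hx hZ ha hb hu hv huv hM1 hdeepM hs.le
  refine hsum.trans (ENNReal.ofReal_le_ofReal ?_)
  have h1 := mainSum_le_exp (m := m) (r := 4) hδ hδ1 hx hZ hY s
  have h2 := annSum_le_exp (m := m) (r := 4) hδ hδ1 hδM hx hZ hY hδA
  have h3 := final_constant_le (cG := cM) (CB := CB) (A := A) hδ hδ1 hs.le hs25 hcB0 hA0
  have e2 : Real.log Y / (16 * L ^ 2) * (1 / δ) ^ 2 = cB / δ ^ 2 := by rw [hcB]; field_simp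
  rw [e2] at h2
  calc mainSum m 4 δ x s + annSum m 4 δ x
      ≤ A / δ ^ 2 * Real.exp (-(cM * s)) + CB * Real.exp (-(cB / δ ^ 2)) := add_le_add h1 h2
    _ ≤ max (CB * Real.exp (-(cB / δ ^ 2))) 0 + A / δ ^ 2 * Real.exp (-(cM * s)) := by
        rw [add_comm]; exact add_le_add (le_max_left _ _) le_rfl
    _ ≤ (A + max CB 0) / δ ^ 2 * Real.exp (-(min cM (cB / 25) * s)) := h3

/-- **Theorem 1 of Duminil-Copin–Kozma–Yadin 2014 (proved).** [cite: DuminilCopinKozmaYadin2014, Theorem 1] -/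
theorem DKY2014_thm1_holds : DKY2014_thm1 :=
  DKY2014_thm1_of_thm6_disk DKY2014_thm6_disk_holds

end SupercriticalSAW

/-- **The barrier `SupercriticalSAWSpaceFilling` holds**: supercritical self-avoiding walks in the
unit disk are space-filling (Theorem 1 of Duminil-Copin–Kozma–Yadin 2014, proved here in full
from Proposition 3, the tile form of Proposition 7 and the Peierls sum).
[cite: DuminilCopinKozmaYadin2014, Theorem 1] -/
theorem SupercriticalSAWSpaceFilling_holds : SupercriticalSAWSpaceFilling :=
  SupercriticalSAW.DKY2014_thm1_holds

end Literature.Barriers.CriticalPhenomena
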